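import Summits.Schanuel.Schanuel.Theorems.ZilberEacExpExpBalanceGeneral
import Summits.Schanuel.Schanuel.Theorems.ZilberEacMovingLine
import HarnessLib

/-!
# The exponential–exponential balance over lines of non-real slope: every target `A`

Zilber's Exponential-Algebraic Closedness, case ladder (host summit Schanuel, cell `pub-schanuel`,
seat 2, gen 8).  `unprojectedDense_movingLine_of_im_ne_zero` (lines `x₁ = a x₀ + b` of NON-REAL
slope, `ZilberEacMovingLine`) needed `A ≠ 0` (lattice centres at `log A(2πik)`).  The balance
mechanism of `ZilberEacExpExpBalanceGeneral` works for lines too — with a CONSTANT local coordinate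
`λ = 1/(1 - e a)` and NO linearisation error — and needs `F ≠ 0` instead: for `Im a ≠ 0`, ANY
`A ∈ ℂ[x]` (also `A = 0` or constant) and `F ≠ 0` the equation `e^{z} = A(z) + e^{az+b}F(e^{az+b})` has
solutions with `Re(az+b) ≥ ρ k`, `‖az+b‖ ≤ C k` (`exists_solution_expExp_line`), hence (THEOREM G) the
exponential points of `W(a, b; A, F) = {x₁ = a x₀ + b, y₀ = A(x₀) + y₁F(y₁)}` are ZARISKI DENSE
(`unprojectedDense_movingLine_of_im_ne_zero_of_ne_zero`); together: dense as soon as `A ≠ 0 ∨ F ≠ 0`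
(`unprojectedDense_movingLine_of_im_ne_zero'`), i.e. whenever `W` meets the torus.

HONEST FRAMING: instances of Mantova–Masser's OPEN density question (existence = their Thm 1.1);
`EC(3,2)` OPEN; NOT Schanuel's conjecture; EAC ⇏ SC.
-/

noncomputable section

open Complex Filter Topology Metric
open Literature.NumberTheory.Transcendental Literature.ModelTheory.Zilber

set_option linter.dupNamespace false

namespace Summit.Schanuel.Schanuel.Theorems

/-- **Balance over a line of non-real slope.**  `Im a ≠ 0`, `b ∈ ℂ`, ANY `A ∈ ℂ[x]`, `F ≠ 0`: there
are `ρ > 0`, `C` with, for all large `k`, a solution of `e^{z} = A(z) + e^{az+b}F(e^{az+b})` with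
`ρ k ≤ Re(az+b)` and `‖az+b‖ ≤ C k`. (new) [cite: MantovaMasser2023, §1 Further remarks] -/
theorem exists_solution_expExp_line {a : ℂ} (ha : a.im ≠ 0) (b : ℂ) (A : Polynomial ℂ)
    {F : Polynomial ℂ} (hF : F ≠ 0) :
    ∃ ρ C : ℝ, 0 < ρ ∧ ∀ᶠ k : ℕ in atTop, ∃ z : ℂ,
      exp z = A.eval z + exp (a * z + b) * F.eval (exp (a * z + b)) ∧
      ρ * k ≤ (a * z + b).re ∧ ‖a * z + b‖ ≤ C * k := by
  classical
  -- ### names and constants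
  set e : ℕ := F.natDegree + 1 with he
  have hepos : 0 < e := by positivity
  have hepos' : (0 : ℝ) < e := by exact_mod_cast hepos
  have he1 : (1 : ℝ) ≤ e := by exact_mod_cast hepos
  set c : ℂ := F.leadingCoeff with hcdef
  have hc0 : c ≠ 0 := Polynomial.leadingCoeff_ne_zero.2 hF
  have hcpos : 0 < ‖c‖ := norm_pos_iff.2 hc0
  set Λ : ℂ := log c with hΛ
  have hexpΛ : exp Λ = c := Complex.exp_log hc0
  set p : Polynomial ℂ := linePoly a b with hp
  have hpev : ∀ z, p.eval z = a * z + b := fun z => eval_linePoly a b z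
  have hpder : ∀ z, p.derivative.eval z = a := fun z => by simp [hp, linePoly]
  -- the sign `σ` with `σ Im a > 0`
  obtain ⟨σ, hσ, hσpos⟩ : ∃ σ : ℤ, (σ = 1 ∨ σ = -1) ∧ 0 < (σ : ℝ) * a.im := by
    rcases lt_or_gt_of_ne ha with h | h
    · exact ⟨-1, Or.inr rfl, by push_cast; nlinarith⟩
    · exact ⟨1, Or.inl rfl, by push_cast; linarith⟩
  have hσnorm : ‖(σ : ℂ)‖ = 1 := by rcases hσ with rfl | rfl <;> simp
  -- `w = e a - 1 ≠ 0`, the constant coordinate `l = 1/(1 - e a)`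
  set w : ℂ := (e : ℂ) * a - 1 with hw
  have hwim : w.im = e * a.im := by simp [hw, Complex.mul_im]
  have hw0 : w ≠ 0 := by
    intro h; have := congrArg Complex.im h
    rw [hwim, Complex.zero_im] at this
    exact ha ((mul_eq_zero.1 this).resolve_left hepos'.ne')
  have hwpos : 0 < Complex.normSq w := Complex.normSq_pos.2 hw0
  set l : ℂ := (1 - (e : ℂ) * a)⁻¹ with hl
  have hne : (1 - (e : ℂ) * a) ≠ 0 := by
    intro h; apply hw0; rw [hw]; linear_combination -h
  have hl_eq : l * (1 - (e : ℂ) * a) = 1 := inv_mul_cancel₀ hne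
  set L : ℝ := ‖l‖ with hL
  -- the roots `z₀ k = (V k - e b)/w`, `V k = 2πiσk - Λ`: `z₀ k = k ξ + z₀₀`
  set V : ℕ → ℂ := fun k => 2 * Real.pi * I * ((σ * k : ℤ) : ℂ) - Λ with hV
  set ξ : ℂ := 2 * Real.pi * (σ : ℂ) * I / w with hξ
  set z₀₀ : ℂ := (-Λ - (e : ℂ) * b) / w with hz₀₀
  set z₀ : ℕ → ℂ := fun k => (k : ℂ) * ξ + z₀₀ with hz₀
  have hroot : ∀ k : ℕ, (e : ℂ) * p.eval (z₀ k) - z₀ k - V k = 0 := by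
    intro k
    rw [hpev]
    simp only [hz₀, hξ, hz₀₀, hV]
    push_cast
    field_simp
    ring
  have hΛV : ∀ k : ℕ, Λ + V k = 2 * Real.pi * I * ((σ * k : ℤ) : ℂ) := fun k => by
    simp only [hV]; ring
  have hVre : ∀ k : ℕ, (V k).re = -Λ.re := fun k => by
    simp only [hV]; push_cast; simp [Complex.mul_re, Complex.mul_im]
  have hVnorm : ∀ k : ℕ, ‖V k‖ ≤ 2 * Real.pi * k + ‖Λ‖ := fun k => by
    simp only [hV]
    refine (norm_sub_le _ _).trans ?_
    push_cast
    rw [show (2 * Real.pi * I * ((σ : ℂ) * k) : ℂ) = ((2 * Real.pi * k : ℝ) : ℂ) * (I * σ) by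
      push_cast; ring, norm_mul, norm_mul, Complex.norm_I, hσnorm, mul_one, mul_one,
      Complex.norm_real, Real.norm_eq_abs, abs_of_nonneg (by positivity)]
  -- the growth of `Re z₀`: `Re ξ = κ > 0`
  set κ : ℝ := ξ.re with hκ
  have hκpos : 0 < κ := by
    have : ξ = ((2 * Real.pi * σ : ℝ) : ℂ) * I / w := by simp only [hξ]; push_cast; ring
    rw [hκ, this, Complex.div_re, Complex.mul_I_re, Complex.mul_I_im, Complex.ofReal_re,
      Complex.ofReal_im, neg_zero, zero_mul, zero_div, zero_add, hwim]
    apply div_pos _ hwpos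
    have : 0 < 2 * Real.pi * ((σ : ℝ) * a.im) * e := by positivity
    nlinarith
  have hz₀re : ∀ k : ℕ, (z₀ k).re = κ * k + z₀₀.re := fun k => by
    simp only [hz₀, Complex.add_re]
    rw [show ((k : ℂ) * ξ).re = k * ξ.re by
      rw [show (k : ℂ) = ((k : ℝ) : ℂ) by push_cast; rfl, Complex.re_ofReal_mul]]
    ring
  set M₁ : ℝ := ‖ξ‖ + ‖z₀₀‖ + L + 1 with hM₁
  have hM₁1 : 1 ≤ M₁ := by have := norm_nonneg ξ; have := norm_nonneg z₀₀; have := norm_nonneg l; linarith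
  have hz₀norm : ∀ k : ℕ, 1 ≤ (k : ℝ) → ‖z₀ k‖ + L + 1 ≤ M₁ * k := fun k hk => by
    have h1 : ‖z₀ k‖ ≤ k * ‖ξ‖ + ‖z₀₀‖ := by
      simp only [hz₀]
      refine (norm_add_le _ _).trans ?_
      rw [norm_mul, Complex.norm_natCast]
    have h2 : ‖z₀₀‖ + L + 1 ≤ (‖z₀₀‖ + L + 1) * k :=
      le_mul_of_one_le_right (by positivity) hk
    rw [hM₁]; nlinarith [norm_nonneg ξ]
  -- constants of the perturbation bound
  set BA : ℝ := ∑ i ∈ Finset.range (A.natDegree + 1), ‖A.coeff i‖ with hBA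
  have hBA0 : 0 ≤ BA := Finset.sum_nonneg fun _ _ => norm_nonneg _
  set Be : ℝ := ∑ i ∈ Finset.range (F.eraseLead.natDegree + 1), ‖F.eraseLead.coeff i‖ with hBe
  have hBe0 : 0 ≤ Be := Finset.sum_nonneg fun _ _ => norm_nonneg _
  set T : ℝ := 600 * (Be + 1) * Real.exp 4 / ‖c‖ + 1 with hT
  have hTpos : 0 < T := by positivity
  set c₀ : ℝ := z₀₀.re with hc₀
  -- ### eventual smallness
  have hκk : Tendsto (fun k : ℕ => κ * k) atTop atTop :=
    tendsto_natCast_atTop_atTop.const_mul_atTop hκpos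
  have E3 : ∀ᶠ k : ℕ in atTop, BA * (M₁ / κ) ^ A.natDegree * Real.exp (2 + L - c₀) *
      ((κ * k) ^ A.natDegree * Real.exp (-(κ * k))) ≤ 1 / 600 := by
    have h := ((Real.tendsto_pow_mul_exp_neg_atTop_nhds_zero A.natDegree).comp hκk).const_mul
      (BA * (M₁ / κ) ^ A.natDegree * Real.exp (2 + L - c₀))
    rw [mul_zero] at h
    exact h.eventually (eventually_le_nhds (by norm_num))
  have E4 : ∀ᶠ k : ℕ in atTop, (Be + 1) * (1 / T + T ^ F.natDegree) * Real.exp (2 + L - c₀) *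
      ((κ * k) ^ 0 * Real.exp (-(κ * k))) ≤ 1 / 600 := by
    have h := ((Real.tendsto_pow_mul_exp_neg_atTop_nhds_zero 0).comp hκk).const_mul
      ((Be + 1) * (1 / T + T ^ F.natDegree) * Real.exp (2 + L - c₀))
    rw [mul_zero] at h
    exact h.eventually (eventually_le_nhds (by norm_num))
  have E6 : ∀ᶠ k : ℕ in atTop, 2 * (L + ‖Λ‖ + 2 + |c₀|) ≤ κ * k := hκk.eventually_ge_atTop _
  -- ### conclusion
  refine ⟨κ / (2 * e), M₁ + (2 * Real.pi + ‖Λ‖) + 2, by positivity, ?_⟩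
  filter_upwards [E3, E4, E6, eventually_ge_atTop 1] with k h3 h4 h6 hk1
  have hk1' : (1 : ℝ) ≤ k := by exact_mod_cast hk1
  have hzn := hz₀norm k hk1'
  -- the perturbation bound near `z₀ k`
  have hg : ∀ z ζ u : ℂ, ‖z - z₀ k‖ ≤ L → ‖ζ‖ ≤ 2 →
      F.leadingCoeff * u ^ (F.natDegree + 1) = exp (z - ζ) →
      ‖(A.eval z + u * F.eraseLead.eval u) * exp (ζ - z)‖ ≤ 1 / 200 := by
    intro z ζ u hz hζ hcue
    have hb := expExp_perturbation_bound_of_norm_le A hF hTpos z ζ u hζ hcue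
    rw [← hcdef, ← hBA, ← hBe] at hb
    refine hb.trans ?_
    have hzre : κ * k + c₀ - L ≤ z.re := by
      have h := Complex.abs_re_le_norm (z - z₀ k)
      rw [Complex.sub_re, abs_le, hz₀re] at h
      linarith [h.1]
    have hznorm : ‖z‖ ≤ M₁ * k := by
      have : ‖z‖ ≤ ‖z₀ k‖ + ‖z - z₀ k‖ := by
        calc ‖z‖ = ‖z₀ k + (z - z₀ k)‖ := by ring_nf
          _ ≤ ‖z₀ k‖ + ‖z - z₀ k‖ := norm_add_le _ _
      linarith
    have hMk : max 1 ‖z‖ ≤ (M₁ / κ) * (κ * k) := by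
      rw [show (M₁ / κ) * (κ * k) = M₁ * k by field_simp]
      exact max_le (by nlinarith) hznorm
    have hmax0 : 0 ≤ max 1 ‖z‖ := zero_le_one.trans (le_max_left _ _)
    have hexpz : Real.exp (2 - z.re) ≤ Real.exp (2 + L - c₀) * Real.exp (-(κ * k)) := by
      rw [← Real.exp_add]; exact Real.exp_le_exp.2 (by linarith)
    have hterm1 : BA * max 1 ‖z‖ ^ A.natDegree * Real.exp (2 - z.re) ≤ 1 / 600 := by
      refine le_trans ?_ h3
      calc BA * max 1 ‖z‖ ^ A.natDegree * Real.exp (2 - z.re)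
          ≤ BA * ((M₁ / κ) * (κ * k)) ^ A.natDegree * (Real.exp (2 + L - c₀) * Real.exp (-(κ * k))) :=
            mul_le_mul (mul_le_mul_of_nonneg_left (pow_le_pow_left₀ hmax0 hMk _) hBA0) hexpz
              (by positivity) (by positivity)
        _ = BA * (M₁ / κ) ^ A.natDegree * Real.exp (2 + L - c₀) *
              ((κ * k) ^ A.natDegree * Real.exp (-(κ * k))) := by rw [mul_pow]; ring
    have hterm2 : (Be + 1) * (1 / T + T ^ F.natDegree) * Real.exp (2 - z.re) ≤ 1 / 600 := by
      refine le_trans ?_ h4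
      rw [pow_zero, one_mul, show (Be + 1) * (1 / T + T ^ F.natDegree) * Real.exp (2 + L - c₀) *
        Real.exp (-(κ * k)) = (Be + 1) * (1 / T + T ^ F.natDegree) * (Real.exp (2 + L - c₀) *
        Real.exp (-(κ * k))) by ring]
      exact mul_le_mul_of_nonneg_left hexpz (by positivity)
    have hterm3 : (Be + 1) * Real.exp (2 * 2) / (‖c‖ * T) ≤ 1 / 600 := by
      rw [div_le_iff₀ (by positivity), hT, show (2 : ℝ) * 2 = 4 by norm_num]
      have : ‖c‖ * (600 * (Be + 1) * Real.exp 4 / ‖c‖ + 1) = 600 * (Be + 1) * Real.exp 4 + ‖c‖ := by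
        field_simp
      rw [this]
      linarith [hcpos.le]
    have hsum : (BA * max 1 ‖z‖ ^ A.natDegree + (Be + 1) * (1 / T + T ^ F.natDegree)) *
          Real.exp (2 - z.re) + (Be + 1) * Real.exp (2 * 2) / (‖c‖ * T) =
        BA * max 1 ‖z‖ ^ A.natDegree * Real.exp (2 - z.re) +
          (Be + 1) * (1 / T + T ^ F.natDegree) * Real.exp (2 - z.re) +
          (Be + 1) * Real.exp (2 * 2) / (‖c‖ * T) := by ring
    rw [hsum]
    linarith only [hterm1, hterm2, hterm3]
  -- no linearisation error on a line
  have hh : ∀ t : ℂ, ‖t‖ ≤ 1 → ‖(e : ℂ) *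
      (p.eval (z₀ k + l * t) - p.eval (z₀ k) - p.derivative.eval (z₀ k) * (l * t))‖ ≤ 1 / 200 := by
    intro t _
    rw [hpev, hpev, hpder, show a * (z₀ k + l * t) + b - (a * z₀ k + b) - a * (l * t) = 0 by ring,
      mul_zero, norm_zero]
    norm_num
  have hl_eq' : l * (1 - ((F.natDegree + 1 : ℕ) : ℂ) * p.derivative.eval (z₀ k)) = 1 := by
    rw [hpder]; exact hl_eq
  obtain ⟨z, ζ, heq, hzz₀, hζ2, hpz⟩ :=
    exists_solution_near_root p A F hexpΛ (hΛV k) (hroot k) hl_eq' le_rfl hh hg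
  refine ⟨z, by rw [← hpev]; exact heq, ?_, ?_⟩
  · -- `Re(az+b) = (Re z - Re Λ - Re ζ)/e ≥ (κ/(2e)) k`
    have hre : (e : ℝ) * (p.eval z).re = z.re - Λ.re - ζ.re := by
      have h := congrArg Complex.re hpz
      rw [show ((e : ℂ) * p.eval z).re = (e : ℝ) * (p.eval z).re by
        rw [show (e : ℂ) = ((e : ℝ) : ℂ) by push_cast; rfl, Complex.re_ofReal_mul]] at h
      rw [h, Complex.sub_re, Complex.add_re, hVre]
      ring
    have hzre : κ * k + c₀ - L ≤ z.re := by
      have h := Complex.abs_re_le_norm (z - z₀ k)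
      rw [Complex.sub_re, abs_le, hz₀re] at h
      linarith [h.1]
    have hζre : ζ.re ≤ 2 := (Complex.re_le_norm ζ).trans hζ2
    have hΛre : Λ.re ≤ ‖Λ‖ := Complex.re_le_norm Λ
    have hc₀' : -|c₀| ≤ c₀ := neg_abs_le c₀
    rw [← hpev, div_mul_eq_mul_div, div_le_iff₀ (by positivity)]
    linarith only [hre, hzre, hζre, hΛre, h6, hc₀']
  · -- `‖az+b‖ ≤ ‖z‖ + ‖V k‖ + 2 ≤ C k`
    have h1 : ‖p.eval z‖ ≤ ‖z‖ + ‖V k‖ + ‖ζ‖ := by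
      have h2 : ‖(e : ℂ) * p.eval z‖ = e * ‖p.eval z‖ := by rw [norm_mul, Complex.norm_natCast]
      have h3 : ‖p.eval z‖ ≤ e * ‖p.eval z‖ := le_mul_of_one_le_left (norm_nonneg _) he1
      have h4 : ‖z + V k - ζ‖ ≤ ‖z‖ + ‖V k‖ + ‖ζ‖ :=
        (norm_sub_le _ _).trans (by linarith only [norm_add_le z (V k)])
      rw [← h2, hpz] at h3
      linarith only [h3, h4]
    have hzn' : ‖z‖ ≤ M₁ * k := by
      have : ‖z‖ ≤ ‖z₀ k‖ + ‖z - z₀ k‖ := by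
        calc ‖z‖ = ‖z₀ k + (z - z₀ k)‖ := by ring_nf
          _ ≤ ‖z₀ k‖ + ‖z - z₀ k‖ := norm_add_le _ _
      linarith only [this, hzn, hzz₀]
    have hΛk1 : ‖Λ‖ ≤ ‖Λ‖ * k := le_mul_of_one_le_right (norm_nonneg _) hk1'
    rw [← hpev]
    linarith only [h1, hzn', hVnorm k, hζ2, hΛk1, hk1']

/-- **Density over lines of non-real slope for every target `A`** (`F ≠ 0`): the exponential points of
`W(a, b; A, F)` are Zariski dense (THEOREM G on `x₁ = az+b` along the balance solutions:
`|Re x₁|/log(2 + ‖x₁‖) ≥ ρk/(log(2+C) + log k) → ∞`). (new) [cite: MantovaMasser2023, §1 Further remarks] -/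
theorem unprojectedDense_movingLine_of_im_ne_zero_of_ne_zero {a : ℂ} (ha : a.im ≠ 0) (b : ℂ)
    (A : Polynomial ℂ) {F : Polynomial ℂ} (hF : F ≠ 0) :
    UnprojectedDense (movingLineSurface a b A F) := by
  classical
  obtain ⟨ρ, C, hρ, hev⟩ := exists_solution_expExp_line ha b A hF
  obtain ⟨k₀, hk₀⟩ := eventually_atTop.1 hev
  have hsol : ∀ m : ℕ, ∃ z : ℂ, exp z = A.eval z + exp (a * z + b) * F.eval (exp (a * z + b)) ∧
      ρ * ((max m k₀ : ℕ) : ℝ) ≤ (a * z + b).re ∧ ‖a * z + b‖ ≤ C * ((max m k₀ : ℕ) : ℝ) :=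
    fun m => hk₀ (max m k₀) (le_max_right _ _)
  choose z hz using hsol
  set pt : ℕ → Fin 2 ⊕ Fin 2 → ℂ := fun m => mlPoint a b (z m) with hpt
  have hpS : ∀ m, pt m ∈ movingLineSurface a b A F := fun m => (mlPoint_mem_iff _ _ _ _ _).2 (hz m).1
  have hpΓ : ∀ m, pt m ∈ expGraph ℂ 2 := fun m => mlPoint_mem_expGraph _ _ _
  refine unprojectedDense_of_growth (isIrreducibleClosed_movingLineSurface _ _ _ _)
    (zariskiDim_movingLineSurface _ _ _ _).le 1 hpS hpΓ ?_
  simp only [hpt, mlPoint_inl_one]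
  set C' : ℝ := max C 0 with hC'
  have hC'0 : 0 ≤ C' := le_max_right _ _
  have hApos : 0 < Real.log (2 + C') := Real.log_pos (by linarith)
  have hlow := (tendsto_div_const_add_mul_log hApos zero_le_one).const_mul_atTop hρ
  refine tendsto_atTop_mono' atTop ?_ hlow
  filter_upwards [eventually_ge_atTop (max k₀ 1)] with m hm
  have hm1 : 1 ≤ m := le_of_max_le_right hm
  have hm1' : (1 : ℝ) ≤ m := by exact_mod_cast hm1
  have hmax : max m k₀ = m := max_eq_left (le_of_max_le_left hm)
  obtain ⟨-, hre, hnorm⟩ := hz m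
  rw [hmax] at hre hnorm
  have hnum : ρ * m ≤ |(a * z m + b).re| := hre.trans (le_abs_self _)
  have hnorm' : ‖a * z m + b‖ ≤ C' * m :=
    hnorm.trans (mul_le_mul_of_nonneg_right (le_max_left _ _) (by positivity))
  have hden : Real.log (2 + ‖a * z m + b‖) ≤ Real.log (2 + C') + 1 * Real.log m := by
    rw [one_mul]
    calc Real.log (2 + ‖a * z m + b‖) ≤ Real.log ((2 + C') * m) := by
          refine Real.log_le_log (by positivity) ?_
          nlinarith
      _ = Real.log (2 + C') + Real.log m := Real.log_mul (by positivity) (by positivity)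
  have hdenpos : 0 < Real.log (2 + ‖a * z m + b‖) :=
    Real.log_pos (by linarith [norm_nonneg (a * z m + b)])
  calc ρ * ((m : ℝ) / (Real.log (2 + C') + 1 * Real.log m))
      = (ρ * m) / (Real.log (2 + C') + 1 * Real.log m) := by ring
    _ ≤ |(a * z m + b).re| / (Real.log (2 + C') + 1 * Real.log m) :=
        div_le_div_of_nonneg_right hnum (by rw [one_mul]; linarith [Real.log_natCast_nonneg m])
    _ ≤ |(a * z m + b).re| / Real.log (2 + ‖a * z m + b‖) :=
        div_le_div_of_nonneg_left (abs_nonneg _) hdenpos hden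

/-- **Lines of non-real slope: dense whenever the surface meets the torus** (`A ≠ 0 ∨ F ≠ 0`).
(new) [cite: MantovaMasser2023, §1 Further remarks] -/
theorem unprojectedDense_movingLine_of_im_ne_zero' {a : ℂ} (ha : a.im ≠ 0) (b : ℂ)
    {A F : Polynomial ℂ} (h : A ≠ 0 ∨ F ≠ 0) : UnprojectedDense (movingLineSurface a b A F) := by
  rcases h with hA | hF
  · exact unprojectedDense_movingLine_of_im_ne_zero ha b hA F
  · exact unprojectedDense_movingLine_of_im_ne_zero_of_ne_zero ha b A hF

end Summit.Schanuel.Schanuel.Theorems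

end
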